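import Mathlib
import Summits.KontsevichZagierPeriods.KontsevichZagierPeriods.Theorems.SoloInformedBlockProduct
import HarnessLib
import HarnessLib.Audit

/-!
# SoloInformed — length faces of the first open rung: `G/(π log 2)` and `G/(log 2)²`

Catalan's constant `G = ∑ (−1)ᵏ/(2k+1)²` is the volume of the sub-graph solid
`E_G = {t (1 + x₀²x₁²) ≤ 1} ⊂ [0,1]³` (`soloInformed_value_catalanSolid`), so it lives in the same
dimension `3` as `π·log 2` (the block product `A₁ ⊠ Λ₁ = E_{(1+x₀²)(1+x₁)}`, volume `(π/4) log 2`) and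
as `(log 2)²` (the log square `Λ₂ = E_{(1+x₀)(1+x₁)}`).  The SIGN invariant of `SoloInformedParityFaces`
does not separate `G` from `π log 2` (equal degree `2`, equal sign), and it does not see `(log 2)²` at
all.  The LENGTH invariant of the residency's paper (§3quater: the unipotent radical of the Tannaka
group moves `log̃ 2` by a non-zero constant and fixes `⟦π⟧`, while `G̃` — the cube model of
`Im Li₂(i)`, primitive modulo constants by the Goncharov–Brown coaction at the torsion point `i` —
has length `1`) separates both.  This file records the two faces as exact equivalences:

* **L5** (`LocRung₃`): `E_G` against `A₁ ⊠ Λ₁` — **`NoLocRel ↔ G/(π log 2) ∉ ℚ`**;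
* **L6** (`LocRung₃`): `E_G` against `Λ₂` — **`NoLocRel ↔ G/(log 2)² ∉ ℚ`**;

together with their monomial forms in `P = FormalRep ⧸ relations` (`⟦A₁ ⊠ Λ₁⟧ = ⟦A₁⟧⟦Λ₁⟧`,
`⟦Λ₂⟧ = ⟦Λ₁⟧²`, Lemma K of `SoloInformedBlockProduct`).  Both irrationality statements are OPEN
(even `G ∉ ℚ` is open [Finch 2003, §1.7]); both are faces of the FIRST open rung.

Residency `solo-KontsevichZagierPeriods-informed` (PLAN.md, session s20).
References: M. Kontsevich, D. Zagier, *Periods* (2001), §1.2; F. Brown, *Notes on motivic periods*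
(arXiv:1512.06410), §10; A. B. Goncharov, *Galois symmetries of fundamental groupoids and
noncommutative geometry*, Duke Math. J. 128 (2005), Thm. 1.2; S. R. Finch, *Mathematical constants*
(CUP 2003), §1.7.
-/

noncomputable section

open MeasureTheory Set Filter
open scoped Topology

namespace Summit.KontsevichZagierPeriods.KontsevichZagierPeriods.Theorems

open Literature.NumberTheory.Transcendental Literature.NumberTheory.Transcendental.KZ

/-! ### The block `A₁ ⊠ Λ₁ = E_{(1+x₀²)(1+x₁)}`, volume `(π/4) log 2` -/

/-- `(1 + x₀²)(1 + x₁)`, the block product of the arctangent and the logarithm polynomials. -/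
def soloInformedAtanLogPoly : MvPolynomial (Fin 2) ℚ :=
  soloInformedBlockMul (soloInformedAtanPoly 1) (soloInformedLogPoly 1)

/-- `(1 + x₀²)(1 + x₁) ≥ 1` on the cube. -/
theorem soloInformed_atanLogPoly_ge_one :
    ∀ x ∈ KZ.cube 2, (1 : ℝ) ≤ MvPolynomial.aeval x soloInformedAtanLogPoly :=
  soloInformed_blockMul_ge_one _ _ (soloInformed_atanPoly_ge_one 1) (soloInformed_logPoly_ge_one 1)

/-- **`A₁ ⊠ Λ₁ = {t (1 + x₀²)(1 + x₁) ≤ 1} ⊂ [0,1]³`**, volume `(π/4) log 2`. -/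
def soloInformedAtanLogSolid : IntegralRep 3 :=
  soloInformedSubgraphRep soloInformedAtanLogPoly soloInformed_atanLogPoly_ge_one

/-- `vol (A₁ ⊠ Λ₁) = (π/4) · log 2`. -/
theorem soloInformed_value_atanLogSolid :
    (soloInformedSubgraphRep soloInformedAtanLogPoly soloInformed_atanLogPoly_ge_one).value =
      Real.pi / 4 * Real.log 2 :=
  (soloInformed_value_blockRep (soloInformedAtanPoly 1) (soloInformedLogPoly 1)
    (soloInformed_atanPoly_ge_one 1) (soloInformed_logPoly_ge_one 1)).trans (by
      rw [show (soloInformedSubgraphRep (soloInformedAtanPoly 1) (soloInformed_atanPoly_ge_one 1)).value =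
          (Real.pi / 4) ^ 1 from soloInformed_value_atanSolid 1,
        show (soloInformedSubgraphRep (soloInformedLogPoly 1) (soloInformed_logPoly_ge_one 1)).value =
          Real.log 2 ^ 1 from soloInformed_value_logSolid 1, pow_one, pow_one])

/-- `⟦A₁ ⊠ Λ₁⟧ = ⟦A₁⟧ · ⟦Λ₁⟧` in `P` (Lemma K). -/
theorem soloInformed_toFormalPeriod_atanLogSolid :
    toFormalPeriod (of soloInformedAtanLogSolid) =
      toFormalPeriod (of (soloInformedAtanSolid 1)) * toFormalPeriod (of (soloInformedLogSolid 1)) :=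
  (soloInformed_toFormalPeriod_blockRep (soloInformedAtanPoly 1) (soloInformedLogPoly 1)
    (soloInformed_atanPoly_ge_one 1) (soloInformed_logPoly_ge_one 1) soloInformed_atanLogPoly_ge_one).symm

/-! ### Face L5 (`LocRung₃`): `E_G` against `A₁ ⊠ Λ₁` — `G/(π log 2)` -/

/-- **`G/(π log 2) ∉ ℚ`** — OPEN (even the irrationality of `G` is open [Finch 2003, §1.7]; a
consequence of the conjectured algebraic independence of `π`, `log 2` and `G`). -/
@[conjecture] def SoloInformedCatalanOverPiLogTwoIrrational : Prop :=
  Irrational (catalanConstant / (Real.pi * Real.log 2))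

/-- **`NoLocRel(G, A₁ ⊠ Λ₁)`**: no `N` and no positive `a, b` with
`⟦[π]⟧ᴺ · ⟦a·[E_G] − b·[A₁ ⊠ Λ₁]⟧ = 0`, where `E_G = {t (1 + x₀²x₁²) ≤ 1}` (volume `G`) and
`A₁ ⊠ Λ₁ = {t (1+x₀²)(1+x₁) ≤ 1}` (volume `(π/4) log 2`) are solids in `[0,1]³` (proved in the
residency's paper, §3quater, from the length invariant granting its input `(Λ_G)`; OPEN as a
kernel statement). -/
@[conjecture] def SoloInformedCatalanAtanLogNoLocRelation : Prop :=
  ∀ N a b : ℕ, a ≠ 0 → b ≠ 0 →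
    toFormalPeriod (of piRep) ^ N *
      toFormalPeriod (a • of soloInformedCatalanSolid - b • of soloInformedAtanLogSolid) ≠ 0

/-- `vol E_G / vol (A₁ ⊠ Λ₁) ∉ ℚ ↔ G/(π log 2) ∉ ℚ` (the factor `4 ∈ ℚˣ`). -/
theorem soloInformed_faceL5_ratio_iff :
    Irrational ((soloInformedSubgraphRep soloInformedCatalanPoly soloInformed_catalanPoly_ge_one).value /
        (soloInformedSubgraphRep soloInformedAtanLogPoly soloInformed_atanLogPoly_ge_one).value) ↔
      SoloInformedCatalanOverPiLogTwoIrrational := by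
  rw [show (soloInformedSubgraphRep soloInformedCatalanPoly soloInformed_catalanPoly_ge_one).value =
      catalanConstant from soloInformed_value_catalanSolid, soloInformed_value_atanLogSolid]
  have hπ : Real.pi ≠ 0 := Real.pi_pos.ne'
  have hl : Real.log 2 ≠ 0 := (Real.log_pos one_lt_two).ne'
  refine soloInformed_irrational_congr_ratMul (4 : ℚ) (by norm_num) ?_
  push_cast
  field_simp

/-- **Face L5: `LocRung₃ → (NoLocRel(G, A₁ ⊠ Λ₁) ↔ G/(π log 2) ∉ ℚ)`.** -/
theorem soloInformed_locRung_three_faceL5_iff (h : SoloInformedLocVolumeRung 3) :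
    SoloInformedCatalanAtanLogNoLocRelation ↔ SoloInformedCatalanOverPiLogTwoIrrational :=
  (soloInformed_locRung_subgraphNoLocRelation_iff soloInformedCatalanPoly soloInformedAtanLogPoly
    soloInformed_catalanPoly_ge_one soloInformed_atanLogPoly_ge_one h).trans soloInformed_faceL5_ratio_iff

/-- `Rung₃ → (NoLocRel(G, A₁ ⊠ Λ₁) ↔ G/(π log 2) ∉ ℚ)`. -/
theorem soloInformed_rung_three_faceL5_iff (h : SoloInformedVolumeRung 3) :
    SoloInformedCatalanAtanLogNoLocRelation ↔ SoloInformedCatalanOverPiLogTwoIrrational :=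
  soloInformed_locRung_three_faceL5_iff (soloInformed_locVolumeRung_of_volumeRung h)

/-- `G/(π log 2) ∉ ℚ → NoLocRel(G, A₁ ⊠ Λ₁)`, unconditionally. -/
theorem soloInformed_faceL5_of_irrational (hirr : SoloInformedCatalanOverPiLogTwoIrrational) :
    SoloInformedCatalanAtanLogNoLocRelation := fun N a b ha _ =>
  soloInformed_subgraphNoLocRelation_of_irrational _ _ _ _ (soloInformed_faceL5_ratio_iff.2 hirr) N a b ha

/-- Face L5 in monomial form: `NoLocRel(G, A₁ ⊠ Λ₁) ↔ ∀ N, ∀ a b ≥ 1, ⟦π⟧ᴺ (a ⟦E_G⟧ − b ⟦A₁⟧⟦Λ₁⟧) ≠ 0`. -/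
theorem soloInformed_faceL5_monomial_iff :
    SoloInformedCatalanAtanLogNoLocRelation ↔
      ∀ N a b : ℕ, a ≠ 0 → b ≠ 0 →
        toFormalPeriod (of piRep) ^ N *
          (a • toFormalPeriod (of soloInformedCatalanSolid) -
            b • (toFormalPeriod (of (soloInformedAtanSolid 1)) *
              toFormalPeriod (of (soloInformedLogSolid 1)))) ≠ 0 := by
  simp only [SoloInformedCatalanAtanLogNoLocRelation, map_sub, map_nsmul,
    soloInformed_toFormalPeriod_atanLogSolid]

/-! ### Face L6 (`LocRung₃`): `E_G` against the log square `Λ₂` — `G/(log 2)²` -/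

/-- **`G/(log 2)² ∉ ℚ`** — OPEN (as for L5). -/
@[conjecture] def SoloInformedCatalanOverLogTwoSqIrrational : Prop :=
  Irrational (catalanConstant / Real.log 2 ^ 2)

/-- **`NoLocRel(G, Λ₂)`**: no `N` and no positive `a, b` with `⟦[π]⟧ᴺ · ⟦a·[E_G] − b·[Λ₂]⟧ = 0`,
where `Λ₂ = {t (1+x₀)(1+x₁) ≤ 1} ⊂ [0,1]³` (volume `(log 2)²`) (proved in the residency's paper,
§3quater, granting `(Λ_G)`: `G̃` has length `1`, `(log̃ 2)²` has length `2`; OPEN as a kernel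
statement). -/
@[conjecture] def SoloInformedCatalanLogSqNoLocRelation : Prop :=
  ∀ N a b : ℕ, a ≠ 0 → b ≠ 0 →
    toFormalPeriod (of piRep) ^ N *
      toFormalPeriod (a • of soloInformedCatalanSolid - b • of (soloInformedLogSolid 2)) ≠ 0

/-- `vol E_G / vol Λ₂ ∉ ℚ ↔ G/(log 2)² ∉ ℚ`. -/
theorem soloInformed_faceL6_ratio_iff :
    Irrational ((soloInformedSubgraphRep soloInformedCatalanPoly soloInformed_catalanPoly_ge_one).value /
        (soloInformedSubgraphRep (soloInformedLogPoly 2) (soloInformed_logPoly_ge_one 2)).value) ↔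
      SoloInformedCatalanOverLogTwoSqIrrational := by
  rw [show (soloInformedSubgraphRep soloInformedCatalanPoly soloInformed_catalanPoly_ge_one).value =
      catalanConstant from soloInformed_value_catalanSolid,
    show (soloInformedSubgraphRep (soloInformedLogPoly 2) (soloInformed_logPoly_ge_one 2)).value =
      Real.log 2 ^ 2 from soloInformed_value_logSolid 2]
  rfl

/-- **Face L6: `LocRung₃ → (NoLocRel(G, Λ₂) ↔ G/(log 2)² ∉ ℚ)`.** -/
theorem soloInformed_locRung_three_faceL6_iff (h : SoloInformedLocVolumeRung 3) :
    SoloInformedCatalanLogSqNoLocRelation ↔ SoloInformedCatalanOverLogTwoSqIrrational :=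
  (soloInformed_locRung_subgraphNoLocRelation_iff soloInformedCatalanPoly (soloInformedLogPoly 2)
    soloInformed_catalanPoly_ge_one (soloInformed_logPoly_ge_one 2) h).trans soloInformed_faceL6_ratio_iff

/-- `Rung₃ → (NoLocRel(G, Λ₂) ↔ G/(log 2)² ∉ ℚ)`. -/
theorem soloInformed_rung_three_faceL6_iff (h : SoloInformedVolumeRung 3) :
    SoloInformedCatalanLogSqNoLocRelation ↔ SoloInformedCatalanOverLogTwoSqIrrational :=
  soloInformed_locRung_three_faceL6_iff (soloInformed_locVolumeRung_of_volumeRung h)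

/-- `G/(log 2)² ∉ ℚ → NoLocRel(G, Λ₂)`, unconditionally. -/
theorem soloInformed_faceL6_of_irrational (hirr : SoloInformedCatalanOverLogTwoSqIrrational) :
    SoloInformedCatalanLogSqNoLocRelation := fun N a b ha _ =>
  soloInformed_subgraphNoLocRelation_of_irrational _ _ _ _ (soloInformed_faceL6_ratio_iff.2 hirr) N a b ha

/-- Face L6 in monomial form: `NoLocRel(G, Λ₂) ↔ ∀ N, ∀ a b ≥ 1, ⟦π⟧ᴺ (a ⟦E_G⟧ − b ⟦Λ₁⟧²) ≠ 0`. -/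
theorem soloInformed_faceL6_monomial_iff :
    SoloInformedCatalanLogSqNoLocRelation ↔
      ∀ N a b : ℕ, a ≠ 0 → b ≠ 0 →
        toFormalPeriod (of piRep) ^ N *
          (a • toFormalPeriod (of soloInformedCatalanSolid) -
            b • toFormalPeriod (of (soloInformedLogSolid 1)) ^ 2) ≠ 0 := by
  simp only [SoloInformedCatalanLogSqNoLocRelation, map_sub, map_nsmul,
    show toFormalPeriod (of (soloInformedLogSolid 2)) = toFormalPeriod (of (soloInformedLogSolid 1)) ^ 2
      from soloInformed_toFormalPeriod_logSolid_succ 1]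

/-! ### Under the conjecture -/

/-- **Two more faces of the first open rung.**  Under `KontsevichZagierPeriods` the no-certificate
statements L5, L6 are EXACTLY the open statements `G/(π log 2) ∉ ℚ`, `G/(log 2)² ∉ ℚ`; next to
`Rung₃ → (NoRel(G) ↔ G ∉ ℚ)` (`SoloInformedWallFaces`) and `Rung₃ → (NoLocRel(G, A₂) ↔ G/π² ∉ ℚ)`
(`SoloInformedParityFaces`). -/
theorem soloInformed_kz_lengthFacesCatalan (hKZ : KontsevichZagierPeriods) :
    (SoloInformedCatalanAtanLogNoLocRelation ↔ SoloInformedCatalanOverPiLogTwoIrrational) ∧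
    (SoloInformedCatalanLogSqNoLocRelation ↔ SoloInformedCatalanOverLogTwoSqIrrational) :=
  ⟨soloInformed_locRung_three_faceL5_iff (soloInformed_locVolumeRung_of_kzp hKZ 3),
    soloInformed_locRung_three_faceL6_iff (soloInformed_locVolumeRung_of_kzp hKZ 3)⟩

end Summit.KontsevichZagierPeriods.KontsevichZagierPeriods.Theorems

end
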